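import Summits.CriticalPhenomena.PercolationContinuityZ3.Theorems.PercNearOneGluingNoHeavyLowerTailSahiCubeFourResidualFiveA
import Summits.CriticalPhenomena.PercolationContinuityZ3.Theorems.PercNearOneGluingNoHeavyLowerTailSahiCubeFourResidualFiveB
import Summits.CriticalPhenomena.PercolationContinuityZ3.Theorems.PercNearOneGluingNoHeavyLowerTailSahiCubeFourResidualFiveC
import Summits.CriticalPhenomena.PercolationContinuityZ3.Theorems.PercNearOneGluingNoHeavyLowerTailSahiCubeFourResidualSixA
import Summits.CriticalPhenomena.PercolationContinuityZ3.Theorems.PercNearOneGluingNoHeavyLowerTailSahiCubeFourResidualSixB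
import Summits.CriticalPhenomena.PercolationContinuityZ3.Theorems.PercNearOneGluingNoHeavyLowerTailSahiCubeFourResidual
import Summits.CriticalPhenomena.PercolationContinuityZ3.Theorems.PercNearOneGluingNoHeavyLowerTailSahiCubeThreeAllOrders
import Literature.Combinatorics.Sahi2008.GeneratingFunction
import Mathlib.Order.Hom.Set

/-!
# `NoHeavyLowerTail` (stmt-CriticalPhenomena-4575) — **SAHI'S `n`-FUNCTION CONJECTURE AT EVERY ORDER ON THE FOUR-DIMENSIONAL CUBE,
# FOR EVERY PRODUCT MEASURE**

Support file, seat `prim-l12-p5` (gen 5), `--supports stmt-CriticalPhenomena-4575`, COMPUTATIONAL (through the kernel-evaluated rows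
`…SahiCubeFourResidualFive{A,B,C}` / `…Six{A,B}` and the kernel `C₃`, `C₄` on four coins).  Sahi [Combinatorica 28 (2008), Conj. 5] /
Lieb–Sahi [J. Math. Phys. 63 (2022), Conj. 1.1] ask `E_n(f_1,…,f_n) ≥ 0` for nonnegative monotone functions on an FKG poset, every `n`
("beyond the special cases treated in [Sahi2008], Conjecture 1.1 remains a conjecture, even for `n = 3, 4, 5`"; tree:
`Summit.….SahiConjecture`, OPEN; in print: cumulations (all `n`), `|X| ≤ 2`, Lebesgue on `[0,1]²`; tree before this file: all orders on `≤ 3` coins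
for every FKG weight (`SahiCubeAllOrders.sahiPositive_cube_three`), `C₃`, `C₄` on four coins for product weights).

* `sahiE_five_ind_nonneg_fin_four_of_nonabsorbing`, `sahiE_six_ind_nonneg_fin_four_of_nonabsorbing` — the two residual hypotheses of
  `SahiHereditaryMeetAbsorption.sahiPositive_bernoulliWeight_all_fin_four_of_residual` (gen 4), discharged by the five- and six-copy digit tests
  (`NCopyCert.sahiE_five/six_ind_nonneg_of_rows` with the rows) — `E₅ ≥ 0` on the 31 968 and `E₆ ≥ 0` on the 4 096 non-absorbing families;
* **`sahiPositive_bernoulliWeight_fin_four`** — for every `p : Fin 4 → [0,1]` and EVERY `n`, `SahiPositive (bernoulliWeight p) n`: Sahi's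
  conjecture holds at all orders for every product measure on `{0,1}^4` (orders `≤ 2` Harris/FKG, `3, 4` the kernel certificates, `5, 6` here,
  `≥ 7` the width collapse of `prim-masterthm-p4`);
* `sahiE_ind_nonneg_fin_four` — event form: `E_n(1_{A_1},…,1_{A_n}) ≥ 0` for any `n` increasing events of `Set (Fin 4)` (repetitions allowed);
* `coeff_sahiSeries_nonneg_fin_four` — hence Sahi's GENERATING-FUNCTION conjecture [Sahi2008, Conj. 4; LiebSahi2021, Conj. 1.2] for every
  sequence of nonnegative monotone functions on `2^{Fin 4}` under a product weight (Lieb–Sahi Thm 4.4, tree);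
* `sahiPositive_bernoulliWeight_of_card_le_four` — any index type with at most four elements (relabelling = push-forward along
  `Equiv.Set.congr`; `≤ 3` elements is the tree's `SahiCubeAllOrders.sahiPositive_set_of_card_le_three`); `sahiPositive_bernoulliWeightDual_of_card_le_four`,
  `sahiE_ind_nonneg_of_isLowerSet_card_le_four` — the order dual: DECREASING events (percolation separations) on `≤ 4` coordinates, all orders.

No sorries; axioms standard plus the `native_decide` certificates (`Lean.ofReduceBool`) of the row files and of the kernel `C₃/C₄`.
-/

namespace Summit.CriticalPhenomena.PercolationContinuityZ3.Theorems.NCopyCert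

open Finset OneCutCert SahiC3Cube PowerSeries
open Literature.Combinatorics.Sahi2008
open Literature.Probability.Percolation.DecisionTree (ind ind_nonneg)

/-- The coefficient bound at order `5` on four coins fits the digit base `2^28`. [this file] -/
theorem coefBound_four_five : coefBound 4 5 < 2 ^ (28 - 1) := by norm_num [coefBound]

/-- The coefficient bound at order `6` on four coins fits the digit base `2^35`. [this file] -/
theorem coefBound_four_six : coefBound 4 6 < 2 ^ (35 - 1) := by norm_num [coefBound]

/-- **`E₅ ≥ 0` on every non-absorbing quintuple of increasing events of `Set (Fin 4)`, every product measure** (rows A–C of the order-5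
residual check). [this file] -/
theorem sahiE_five_ind_nonneg_fin_four_of_nonabsorbing (p : Fin 4 → unitInterval) (A : Fin 5 → Set (Set (Fin 4)))
    (hup : ∀ i, IsUpperSet (A i)) (hna : ∀ q : Fin 5, ∃ ω, (∀ i, i ≠ q → ω ∈ A i) ∧ ω ∉ A q) :
    0 ≤ sahiE (bernoulliWeight p) 5 (fun i => ind (A i)) := by
  refine sahiE_five_ind_nonneg_of_rows (m := 4) (σ := 28) (by norm_num) coefBound_four_five (fun T => ktLook_ktTab 28 6 4 T)
    [fun a => decide (a ≤ 61128), fun a => decide (61128 < a ∧ a ≤ 61162), fun a => decide (61162 < a)] ?_ ?_ p A hup hna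
  · intro a _
    by_cases h1 : a ≤ 61128
    · exact ⟨fun a => decide (a ≤ 61128), List.mem_cons.2 (Or.inl rfl), by simp [h1]⟩
    by_cases h2 : a ≤ 61162
    · exact ⟨fun a => decide (61128 < a ∧ a ≤ 61162), List.mem_cons.2 (Or.inr (List.mem_cons.2 (Or.inl rfl))),
        by simp [h2, not_le.mp h1]⟩
    · exact ⟨fun a => decide (61162 < a),
        List.mem_cons.2 (Or.inr (List.mem_cons.2 (Or.inr (List.mem_cons.2 (Or.inl rfl))))), by simp [not_le.mp h2]⟩
  · intro r hr
    simp only [List.mem_cons, List.mem_nil_iff, or_false] at hr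
    rcases hr with rfl | rfl | rfl
    · exact checkR5W_cube_four_rowA
    · exact checkR5W_cube_four_rowB
    · exact checkR5W_cube_four_rowC

/-- **`E₆ ≥ 0` on every non-absorbing sextuple of increasing events of `Set (Fin 4)`, every product measure** (rows A, B of the order-6
residual check). [this file] -/
theorem sahiE_six_ind_nonneg_fin_four_of_nonabsorbing (p : Fin 4 → unitInterval) (A : Fin 6 → Set (Set (Fin 4)))
    (hup : ∀ i, IsUpperSet (A i)) (hna : ∀ q : Fin 6, ∃ ω, (∀ i, i ≠ q → ω ∈ A i) ∧ ω ∉ A q) :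
    0 ≤ sahiE (bernoulliWeight p) 6 (fun i => ind (A i)) := by
  refine sahiE_six_ind_nonneg_of_rows (m := 4) (σ := 35) (by norm_num) coefBound_four_six (fun T => ktLook_ktTab 35 7 4 T)
    [fun a => decide (a ≤ 61162), fun a => decide (61162 < a)] ?_ ?_ p A hup hna
  · intro a _
    by_cases h1 : a ≤ 61162
    · exact ⟨fun a => decide (a ≤ 61162), List.mem_cons.2 (Or.inl rfl), by simp [h1]⟩
    · exact ⟨fun a => decide (61162 < a), List.mem_cons.2 (Or.inr (List.mem_cons.2 (Or.inl rfl))), by simp [not_le.mp h1]⟩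
  · intro r hr
    simp only [List.mem_cons, List.mem_nil_iff, or_false] at hr
    rcases hr with rfl | rfl
    · exact checkR6W_cube_four_rowA
    · exact checkR6W_cube_four_rowB

/-- **SAHI'S CONJECTURE AT EVERY ORDER ON `{0,1}^4` FOR EVERY PRODUCT MEASURE**: for every `p : Fin 4 → [0,1]` and every `n`, the product weight
`bernoulliWeight p` on the Boolean lattice `Set (Fin 4)` is Sahi-positive of order `n` — `E_n(f_1,…,f_n) ≥ 0` for all nonnegative monotone
`f_1,…,f_n : Set (Fin 4) → ℝ` [Sahi2008, Conj. 5; LiebSahi2021, Conj. 1.1, on this lattice and these weights].  Assembly of: Harris/FKG (`n ≤ 2`),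
the kernel `C₃` (`SahiC3Cube.sahiC3_of_card_le_four`) and `C₄` (`SahiHereditaryMeetAbsorption.sahiC4_cube_four`), the five- and six-copy
certificates of this generation on the residual families, Theorem G′ and the width collapse (`sahiPositive_bernoulliWeight_all_fin_four_of_residual`).
[this file] -/
theorem sahiPositive_bernoulliWeight_fin_four (p : Fin 4 → unitInterval) (n : ℕ) : SahiPositive (bernoulliWeight p) n :=
  SahiHereditaryMeetAbsorption.sahiPositive_bernoulliWeight_all_fin_four_of_residual p
    (sahiE_five_ind_nonneg_fin_four_of_nonabsorbing p) (sahiE_six_ind_nonneg_fin_four_of_nonabsorbing p) n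

/-- **Event form**: for every product measure on `2^{Fin 4}`, every `n` and every `n` increasing events `A_1,…,A_n ⊆ Set (Fin 4)` (repetitions
allowed), `E_n(1_{A_1},…,1_{A_n}) ≥ 0`. [this file] -/
theorem sahiE_ind_nonneg_fin_four (p : Fin 4 → unitInterval) (n : ℕ) (A : Fin n → Set (Set (Fin 4)))
    (hup : ∀ i, IsUpperSet (A i)) : 0 ≤ sahiE (bernoulliWeight p) n (fun i => ind (A i)) :=
  sahiPositive_bernoulliWeight_fin_four p n _ (fun _ _ => ind_nonneg _ _) (fun i => monotone_ind_of_isUpperSet (hup i))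

/-- **Sahi's generating-function conjecture on four coins** [Sahi2008, Conj. 4; LiebSahi2021, Conj. 1.2]: for every product weight `μ_p` on
`2^{Fin 4}` and every sequence `f_1, f_2, …` of nonnegative monotone functions, every coefficient of `1 − Π_x (1 − Σ_i f_i(x) t^i)^{μ_p(x)}` is
`≥ 0` (Lieb–Sahi Thm 4.4 applied to `sahiPositive_bernoulliWeight_fin_four`). [this file] -/
theorem coeff_sahiSeries_nonneg_fin_four (p : Fin 4 → unitInterval) (f : ℕ → Set (Fin 4) → ℝ)
    (hf0 : ∀ i x, 0 ≤ f i x) (hfm : ∀ i, Monotone (f i)) (M : ℕ) :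
    0 ≤ coeff M (sahiSeries (bernoulliWeight p) f) :=
  coeff_sahiSeries_nonneg_of_forall_sahiE_nonneg (bernoulliWeight p) (sum_bernoulliWeight p)
    (fun g => (∀ x, 0 ≤ g x) ∧ Monotone g)
    (fun n g hg => sahiPositive_bernoulliWeight_fin_four p n g (fun i => (hg i).1) (fun i => (hg i).2))
    f (fun i => ⟨hf0 i, hfm i⟩) M

/-! ## Any index type with at most four elements; decreasing events -/

/-- A product weight is the push-forward of the relabelled product weight along the induced lattice isomorphism `Set ι ≃ Set ι'`.
[this file] -/
theorem bernoulliWeight_eq_pushWeight_congr {ι ι' : Type*} [Fintype ι] [Fintype ι'] (e : ι ≃ ι') (q : ι' → unitInterval) :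
    bernoulliWeight q = pushWeight (bernoulliWeight fun i => q (e i)) (Equiv.Set.congr e) := by
  classical
  funext c
  rw [pushWeight_equiv]
  show bernoulliWeight q c = bernoulliWeight (fun i => q (e i)) (e.symm '' c)
  simp only [bernoulliWeight, Literature.Probability.Percolation.BHK2006.weight]
  rw [← Fintype.prod_equiv e (fun i => if i ∈ e.symm '' c then ((q (e i) : ℝ)) else 1 - (q (e i) : ℝ))
    (fun j => if j ∈ c then (q j : ℝ) else 1 - (q j : ℝ))]
  intro i
  have hmem : i ∈ e.symm '' c ↔ e i ∈ c := by
    rw [Equiv.image_eq_preimage_symm, Equiv.symm_symm]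
    simp
  by_cases h : e i ∈ c
  · rw [if_pos (hmem.2 h), if_pos h]
  · rw [if_neg (fun h' => h (hmem.1 h')), if_neg h]

/-- **Sahi's conjecture at every order for every product measure on at most four coordinates** (any index type). [this file] -/
theorem sahiPositive_bernoulliWeight_of_card_le_four {ι : Type*} [Fintype ι] (hι : Fintype.card ι ≤ 4) (q : ι → unitInterval) (n : ℕ) :
    SahiPositive (bernoulliWeight q) n := by
  classical
  rcases Nat.lt_or_ge (Fintype.card ι) 4 with h | h
  · exact SahiCubeAllOrders.sahiPositive_set_of_card_le_three (by omega) (isFKGMeasure_bernoulliWeight q) n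
  · have hcard : Fintype.card ι = 4 := le_antisymm hι h
    let e : Fin 4 ≃ ι := (finCongr hcard).symm.trans (Fintype.equivFin ι).symm
    rw [bernoulliWeight_eq_pushWeight_congr e q]
    exact (sahiPositive_bernoulliWeight_fin_four _ n).of_pushWeight fun s t hst => Set.image_mono hst

/-- The dual product weight (decreasing events) is the push-forward of the reflected product weight `q ↦ 1 − q` along complementation
`Set ι ≃o (Set ι)ᵒᵈ`. [this file] -/
theorem bernoulliWeightDual_eq_pushWeight_compl {ι : Type*} [Fintype ι] (q : ι → unitInterval) :
    bernoulliWeightDual q = pushWeight (bernoulliWeight fun i => unitInterval.symm (q i)) (OrderIso.compl (Set ι)).toEquiv := by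
  classical
  funext t
  rw [pushWeight_equiv]
  show bernoulliWeight q (OrderDual.ofDual t) = bernoulliWeight (fun i => unitInterval.symm (q i)) (OrderDual.ofDual t)ᶜ
  simp only [bernoulliWeight, Literature.Probability.Percolation.BHK2006.weight, unitInterval.coe_symm_eq, Set.mem_compl_iff]
  refine Finset.prod_congr rfl fun i _ => ?_
  by_cases h : i ∈ OrderDual.ofDual t
  · rw [if_pos h, if_neg (not_not.2 h)]; ring
  · rw [if_neg h, if_pos h]

/-- **The order dual**: for every product weight on at most four coordinates, the dual weight on `(Set ι)ᵒᵈ` (under which DECREASING events of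
`Set ι` are increasing) is Sahi-positive of every order. [this file] -/
theorem sahiPositive_bernoulliWeightDual_of_card_le_four {ι : Type*} [Fintype ι] (hι : Fintype.card ι ≤ 4) (q : ι → unitInterval)
    (n : ℕ) : SahiPositive (bernoulliWeightDual q) n := by
  rw [bernoulliWeightDual_eq_pushWeight_compl]
  exact (sahiPositive_bernoulliWeight_of_card_le_four hι _ n).of_pushWeight (OrderIso.compl (Set ι)).monotone

/-- **Decreasing events** (e.g. percolation separation events): for every product measure on at most four coordinates, every `n` and every
`n` decreasing events `A_1,…,A_n`, `E_n(1_{A_1},…,1_{A_n}) ≥ 0`. [this file] -/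
theorem sahiE_ind_nonneg_of_isLowerSet_card_le_four {ι : Type*} [Fintype ι] (hι : Fintype.card ι ≤ 4) (q : ι → unitInterval)
    (n : ℕ) (A : Fin n → Set (Set ι)) (hA : ∀ i, IsLowerSet (A i)) :
    0 ≤ sahiE (bernoulliWeight q) n (fun i => ind (A i)) := by
  have key := sahiPositive_bernoulliWeightDual_of_card_le_four hι q n (fun i (a : (Set ι)ᵒᵈ) => ind (A i) (OrderDual.ofDual a))
    (fun _ _ => ind_nonneg _ _) (fun i => monotone_ind_toDual_of_isLowerSet (hA i))
  exact key

/-- **Increasing events on at most four coordinates** (any index type, any number of events, repetitions allowed). [this file] -/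
theorem sahiE_ind_nonneg_of_isUpperSet_card_le_four {ι : Type*} [Fintype ι] (hι : Fintype.card ι ≤ 4) (q : ι → unitInterval)
    (n : ℕ) (A : Fin n → Set (Set ι)) (hA : ∀ i, IsUpperSet (A i)) :
    0 ≤ sahiE (bernoulliWeight q) n (fun i => ind (A i)) :=
  sahiPositive_bernoulliWeight_of_card_le_four hι q n _ (fun _ _ => ind_nonneg _ _) (fun i => monotone_ind_of_isUpperSet (hA i))

end Summit.CriticalPhenomena.PercolationContinuityZ3.Theorems.NCopyCert
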